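import Mathlib.Probability.Distributions.Gaussian.Real
import Mathlib.MeasureTheory.Integral.IntegralEqImproper
import Mathlib.Analysis.SpecialFunctions.Gaussian.GaussianIntegral
import Mathlib.MeasureTheory.Constructions.Pi
import Mathlib.MeasureTheory.Integral.Prod
import Literature.Barriers.CriticalPhenomena.RigorousRGSmallParameterGaussianIntegration
import HarnessLib

/-!
# `RigorousRGSmallParameter` (Slade, Theorem 1.4.1): Gaussian integration by parts for `P_C` —
# `E_C[ζ^i_x F(ζ)] = Σ_y C_{xy} E_C[(∂F/∂ζ^i_y)(ζ)]`

Companion ("proof architecture") file of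
`Literature/Barriers/CriticalPhenomena/RigorousRGSmallParameter.lean`, continuing
`…GaussianIntegration` (the Gaussian measure `P_C = fieldGaussian Λ C n` of Slade §4.1 on field
space `Λ → Fin n → ℝ`, for every positive semidefinite `C`, and `E_C θ`). The renormalisation-group
method rests on "basic properties of Gaussian integrals" ([BS-rg-norm] §2; Slade §4.1), the first
of which is **Gaussian integration by parts** `E_C[ζ_u F(ζ)] = Σ_v C_{uv} E_C[∂_vF(ζ)]` — the
identity behind `E_Cθ = e^{½Δ_C}` on polynomials (Wick's theorem) and behind the heat-equation
characterisation of `E_Cθ`. This file PROVES it for `P_C`, degenerate `C` included: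

1. **Stein's lemma** for `N(0,1)`: `∫ x g(x) dγ = ∫ g'(x) dγ` for `C¹` functions with `g, g'` of
   polynomial growth (`stein`; from `∫ f' = 0` for `f = g e^{-x²/2}`, Mathlib's
   `integral_eq_zero_of_hasDerivAt_of_integrable`);
2. the product Gaussian `N(0,1)^{⊗N}` (`piGauss`): integrability of product-polynomially bounded
   functions and IBP in each coordinate (`piGauss_ibp`; Fubini via `piFinSuccAbove`);
3. linear images `μ = A_*N(0,1)^{⊗N}` (centred Gaussians with covariance `aaᵀ`):
   `∫ ζ_u F dμ = Σ_v (aaᵀ)_{uv} ∫ ∂_vF dμ` (`map_ibp`);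
4. **`P_C` is such an image** (`fieldGaussian_eq_map_gaussMap`): unfolding Mathlib's
   `multivariateGaussian 0 (C ⊗ 1ₙ) = (stdGaussian).map √(C ⊗ 1ₙ)` and
   `stdGaussian = (N(0,1)^{⊗}).map (Σ x_i b_i)`, with `√(C⊗1)√(C⊗1)ᵀ = C ⊗ 1ₙ`
   (`CFC.sqrt_mul_sqrt_self`, symmetry of the square root);
5. hence **`fieldGaussian_ibp`**: for positive semidefinite `C` and `C¹` functions `F` with
   `|F(φ)| ≤ B(1+‖φ‖)^p`, `‖DF(φ)‖ ≤ B(1+‖φ‖)^p`,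
   `∫ φ^i_x F(φ) dP_C(φ) = Σ_y C_{xy} ∫ ∂_{(y,i)}F(φ) dP_C(φ)`.

Sources: D. C. Brydges, G. Slade [BS-rg-norm], *A renormalisation group method. I. Gaussian
integration and normed algebras*, J. Stat. Phys. 159 (2015) 421–460, arXiv:1403.7244, §2; G. Slade,
arXiv:1611.06169, §4.1.

## What this file provides (definitions with proved properties; no named fact)

* `one_add_pow_mul_exp_le`, `integrable_mul_exp_of_abs_le`, `integral_gaussianReal_zero_one`,
  **`stein`**, `integrable_gaussianReal_of_abs_le`.
* `piGauss`, `integrable_piGauss_of_abs_le`, `insertNth_eq_add_smul`, `prod_weight_insertNth`,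
  **`piGauss_ibp`**.
* `one_add_sum_le_prod`, `one_add_norm_pow_le_prod`, `lmat`, `apply_eq_sum_lmat`,
  `apply_single_eq_sum`, **`map_ibp`**.
* `flatIdx`, `sqrtCM`, `gaussMap`, `gaussMap_apply`, `pi_eq_map_reindex`,
  **`fieldGaussian_eq_map_gaussMap`**, `sqrtCM_mul_self`, `sqrtCM_transpose`, `sum_sqrtCM_mul_sqrtCM`.
* `curryCLE`, `curryCLE_apply`, `norm_curryCLE`, `fdir`, `curry_single`, **`fieldGaussian_ibp`**.

## References

* [BrydgesSlade2015RGI] D. C. Brydges, G. Slade, *A renormalisation group method. I. Gaussian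
  integration and normed algebras*, J. Stat. Phys. 159 (2015) 421–460, arXiv:1403.7244 — §2.
* [Slade2017] G. Slade, *Critical exponents for long-range O(n) models below the upper critical
  dimension*, Commun. Math. Phys. 358 (2018) 343–436, arXiv:1611.06169 — §4.1.
-/

noncomputable section

namespace Literature.Barriers.CriticalPhenomena

namespace LongRangePhi4

namespace GaussIBP

open MeasureTheory ProbabilityTheory Real Filter Set Matrix WithLp
open scoped Topology MatrixOrder

/-- `(1+s)^p e^{-s²/4} ≤ e^{(p+1)²}` for `s ≥ 0`. [folklore] -/
theorem one_add_pow_mul_exp_le {s : ℝ} (hs : 0 ≤ s) (p : ℕ) : (1 + s) ^ p * rexp (-(s ^ 2 / 4)) ≤ rexp (((p : ℝ) + 1) ^ 2) := by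
  have h1 : (1 + s) ^ p ≤ rexp ((p : ℝ) * s) := by
    calc (1 + s) ^ p ≤ rexp s ^ p := by
          gcongr
          linarith [Real.add_one_le_exp s]
      _ = rexp ((p : ℝ) * s) := by rw [← Real.exp_nat_mul]
  have hkey : (p : ℝ) * s ≤ s ^ 2 / 4 + ((p : ℝ) + 1) ^ 2 := by
    nlinarith [sq_nonneg (s / 2 - (p : ℝ)), sq_nonneg ((p : ℝ) + 1), hs]
  calc (1 + s) ^ p * rexp (-(s ^ 2 / 4)) ≤ rexp ((p : ℝ) * s) * rexp (-(s ^ 2 / 4)) :=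
        mul_le_mul_of_nonneg_right h1 (Real.exp_pos _).le
    _ = rexp ((p : ℝ) * s - s ^ 2 / 4) := by rw [← Real.exp_add]; ring_nf
    _ ≤ rexp (((p : ℝ) + 1) ^ 2) := Real.exp_le_exp.2 (by linarith)

/-- **Polynomially bounded functions are integrable against the Gaussian weight**:
`|h| ≤ B(1+|x|)^p ⇒ h e^{-x²/2} ∈ L¹(ℝ)`. [folklore] -/
theorem integrable_mul_exp_of_abs_le {h : ℝ → ℝ} (hm : AEStronglyMeasurable h) {B : ℝ} {p : ℕ}
    (hb : ∀ x, |h x| ≤ B * (1 + |x|) ^ p) : Integrable (fun x => h x * rexp (-x ^ 2 / 2)) := by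
  have hB : 0 ≤ B := by
    have := hb 0
    simp at this
    exact (abs_nonneg _).trans this
  have hg : Integrable (fun x : ℝ => rexp (-(4 : ℝ)⁻¹ * x ^ 2)) := integrable_exp_neg_mul_sq (by norm_num)
  refine ((hg.const_mul (B * rexp (((p : ℝ) + 1) ^ 2))).mono' (hm.mul (by fun_prop)) (ae_of_all _ fun x => ?_))
  rw [Real.norm_eq_abs, abs_mul, abs_of_nonneg (Real.exp_pos _).le]
  have hsplit : rexp (-x ^ 2 / 2) = rexp (-(|x| ^ 2 / 4)) * rexp (-(4 : ℝ)⁻¹ * x ^ 2) := by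
    rw [← Real.exp_add, sq_abs]; ring_nf
  rw [hsplit, ← mul_assoc]
  refine mul_le_mul_of_nonneg_right ?_ (Real.exp_pos _).le
  calc |h x| * rexp (-(|x| ^ 2 / 4)) ≤ B * (1 + |x|) ^ p * rexp (-(|x| ^ 2 / 4)) :=
        mul_le_mul_of_nonneg_right (hb x) (Real.exp_pos _).le
    _ = B * ((1 + |x|) ^ p * rexp (-(|x| ^ 2 / 4))) := by ring
    _ ≤ B * rexp (((p : ℝ) + 1) ^ 2) := mul_le_mul_of_nonneg_left (one_add_pow_mul_exp_le (abs_nonneg x) p) hB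

/-- The Gaussian integral as a weighted Lebesgue integral: `∫ f dN(0,1) = (2π)^{-1/2} ∫ f(x) e^{-x²/2} dx`. [folklore] -/
theorem integral_gaussianReal_zero_one (f : ℝ → ℝ) :
    ∫ x, f x ∂(gaussianReal 0 1) = (√(2 * π))⁻¹ * ∫ x, f x * rexp (-x ^ 2 / 2) := by
  rw [integral_gaussianReal_eq_integral_smul (by norm_num), ← integral_const_mul]
  refine integral_congr_ae (ae_of_all _ fun x => ?_)
  simp only [gaussianPDFReal, smul_eq_mul, NNReal.coe_one, mul_one, sub_zero]
  ring_nf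

/-- **Stein's lemma (Gaussian integration by parts in one dimension)**:
`∫ x g(x) dN(0,1) = ∫ g'(x) dN(0,1)` for `C¹` functions `g` with `g, g'` of polynomial growth. [folklore] -/
theorem stein {g g' : ℝ → ℝ} (hg : ∀ x, HasDerivAt g (g' x) x) (hg'c : Continuous g') {B : ℝ} {p : ℕ}
    (hgb : ∀ x, |g x| ≤ B * (1 + |x|) ^ p) (hg'b : ∀ x, |g' x| ≤ B * (1 + |x|) ^ p) :
    ∫ x, x * g x ∂(gaussianReal 0 1) = ∫ x, g' x ∂(gaussianReal 0 1) := by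
  have hgc : Continuous g := continuous_iff_continuousAt.2 fun x => (hg x).continuousAt
  rw [integral_gaussianReal_zero_one, integral_gaussianReal_zero_one]
  congr 1
  -- `f = g e^{-x²/2}` has derivative `(g' - x g) e^{-x²/2}`, and `∫ f' = 0`
  have hρ : ∀ x, HasDerivAt (fun x => rexp (-x ^ 2 / 2)) (-x * rexp (-x ^ 2 / 2)) x := by
    intro x
    have h1 := (((hasDerivAt_pow 2 x).neg).div_const 2).exp
    refine h1.congr_deriv ?_
    norm_num
    ring
  have hf : ∀ x, HasDerivAt (fun x => g x * rexp (-x ^ 2 / 2)) (g' x * rexp (-x ^ 2 / 2) - x * g x * rexp (-x ^ 2 / 2)) x := by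
    intro x
    exact ((hg x).mul (hρ x)).congr_deriv (by ring)
  have hB : 0 ≤ B := by
    have := hgb 0; simp at this; exact (abs_nonneg _).trans this
  have hint_f : Integrable (fun x => g x * rexp (-x ^ 2 / 2)) :=
    integrable_mul_exp_of_abs_le hgc.aestronglyMeasurable hgb
  have hint_xg : Integrable (fun x => x * g x * rexp (-x ^ 2 / 2)) := by
    refine integrable_mul_exp_of_abs_le (by fun_prop) (B := B) (p := p + 1) fun x => ?_
    rw [abs_mul, pow_succ]
    calc |x| * |g x| ≤ |x| * (B * (1 + |x|) ^ p) := mul_le_mul_of_nonneg_left (hgb x) (abs_nonneg x)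
      _ ≤ (1 + |x|) * (B * (1 + |x|) ^ p) := by
          apply mul_le_mul_of_nonneg_right (by linarith [abs_nonneg x]) (by positivity)
      _ = B * ((1 + |x|) ^ p * (1 + |x|)) := by ring
  have hint_g' : Integrable (fun x => g' x * rexp (-x ^ 2 / 2)) :=
    integrable_mul_exp_of_abs_le hg'c.aestronglyMeasurable hg'b
  have hint_f' : Integrable (fun x => g' x * rexp (-x ^ 2 / 2) - x * g x * rexp (-x ^ 2 / 2)) := hint_g'.sub hint_xg
  have h0 := integral_eq_zero_of_hasDerivAt_of_integrable hf hint_f' hint_f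
  rw [integral_sub hint_g' hint_xg, sub_eq_zero] at h0
  rw [h0]

/-! ### Integrability against `N(0,1)` and against the product Gaussian -/

/-- Polynomially bounded functions are `N(0,1)`-integrable. [folklore] -/
theorem integrable_gaussianReal_of_abs_le {h : ℝ → ℝ} (hm : AEStronglyMeasurable h) {B : ℝ} {p : ℕ}
    (hb : ∀ x, |h x| ≤ B * (1 + |x|) ^ p) : Integrable h (gaussianReal 0 1) := by
  rw [gaussianReal_of_var_ne_zero 0 one_ne_zero, integrable_withDensity_iff (measurable_gaussianPDF 0 1)
    (ae_of_all _ fun _ => gaussianPDF_lt_top)]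
  have h1 := (integrable_mul_exp_of_abs_le hm hb).const_mul ((√(2 * π))⁻¹)
  refine h1.congr (ae_of_all _ fun x => ?_)
  simp only [gaussianPDF, gaussianPDFReal, NNReal.coe_one, mul_one, sub_zero, ENNReal.toReal_ofReal']
  rw [max_eq_left (by positivity)]
  ring_nf

/-- The product Gaussian `N(0,1)^{⊗N}` on `Fin N → ℝ`. [folklore] -/
def piGauss (N : ℕ) : Measure (Fin N → ℝ) := Measure.pi fun _ : Fin N => gaussianReal 0 1

/-- The product Gaussian is a probability measure. [folklore] -/
instance (N : ℕ) : IsProbabilityMeasure (piGauss N) := by unfold piGauss; infer_instance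

/-- The product Gaussian is σ-finite. [folklore] -/
instance (N : ℕ) : SigmaFinite (piGauss N) := by unfold piGauss; infer_instance

/-- **Product-polynomially bounded functions are integrable against the product Gaussian**:
`|F(x)| ≤ B ∏_j (1+|x_j|)^p ⇒ F ∈ L¹(N(0,1)^{⊗N})`. [folklore] -/
theorem integrable_piGauss_of_abs_le {N : ℕ} {F : (Fin N → ℝ) → ℝ} (hm : AEStronglyMeasurable F (piGauss N)) {B : ℝ} {p : ℕ}
    (hb : ∀ x, |F x| ≤ B * ∏ j, (1 + |x j|) ^ p) : Integrable F (piGauss N) := by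
  have h1 : Integrable (fun x : Fin N → ℝ => ∏ j, (1 + |x j|) ^ p) (piGauss N) := by
    have := Integrable.fintype_prod (ι := Fin N) (f := fun _ (t : ℝ) => (1 + |t|) ^ p) (μ := fun _ => gaussianReal 0 1)
      (fun _ => integrable_gaussianReal_of_abs_le (by fun_prop) (B := 1) (p := p) fun t => by
        rw [abs_of_nonneg (by positivity), one_mul])
    simpa [piGauss] using this
  refine (h1.const_mul B).mono' hm (ae_of_all _ fun x => ?_)
  rw [Real.norm_eq_abs]
  exact hb x

/-! ### Gaussian integration by parts for the product Gaussian -/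

/-- Inserting a coordinate is affine: `insertNth i t y = insertNth i 0 y + t·e_i`. [folklore] -/
theorem insertNth_eq_add_smul {N : ℕ} (i : Fin (N + 1)) (t : ℝ) (y : Fin N → ℝ) :
    Fin.insertNth i t y = Fin.insertNth i (0 : ℝ) y + t • (Pi.single i (1 : ℝ) : Fin (N + 1) → ℝ) := by
  ext j
  refine Fin.succAboveCases i ?_ (fun j => ?_) j
  · simp
  · simp [Fin.insertNth_apply_succAbove, Fin.succAbove_ne]

/-- The product weight splits off the `i`-th coordinate. [folklore] -/
theorem prod_weight_insertNth {N : ℕ} (i : Fin (N + 1)) (p : ℕ) (t : ℝ) (y : Fin N → ℝ) :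
    ∏ j, (1 + |Fin.insertNth i t y j|) ^ p = (1 + |t|) ^ p * ∏ j, (1 + |y j|) ^ p := by
  rw [Fin.prod_univ_succAbove _ i]
  simp

/-- **Gaussian integration by parts for `N(0,1)^{⊗(N+1)}`**:
`∫ x_i G(x) dγ(x) = ∫ ∂_iG(x) dγ(x)` for `C¹` functions `G` with `G`, `∂_iG` product-polynomially
bounded. [folklore] -/
theorem piGauss_ibp {N : ℕ} (i : Fin (N + 1)) {G : (Fin (N + 1) → ℝ) → ℝ} (hG : ContDiff ℝ 1 G) {B : ℝ} {p : ℕ}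
    (hGb : ∀ x, |G x| ≤ B * ∏ j, (1 + |x j|) ^ p)
    (hG'b : ∀ x, |fderiv ℝ G x (Pi.single i 1)| ≤ B * ∏ j, (1 + |x j|) ^ p) :
    ∫ x, x i * G x ∂(piGauss (N + 1)) = ∫ x, fderiv ℝ G x (Pi.single i 1) ∂(piGauss (N + 1)) := by
  have hGc : Continuous G := hG.continuous
  have hG'c : Continuous fun x => fderiv ℝ G x (Pi.single i 1) := (hG.continuous_fderiv one_ne_zero).clm_apply continuous_const
  have hB : 0 ≤ B := by
    have := hGb 0
    have h1 : (0 : ℝ) ≤ ∏ j : Fin (N + 1), (1 + |(0 : Fin (N + 1) → ℝ) j|) ^ p := by positivity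
    have h2 : ∏ j : Fin (N + 1), (1 + |(0 : Fin (N + 1) → ℝ) j|) ^ p = 1 := by simp
    rw [h2, mul_one] at this
    exact (abs_nonneg _).trans this
  -- integrability on the product
  have hint1 : Integrable (fun x => x i * G x) (piGauss (N + 1)) := by
    refine integrable_piGauss_of_abs_le (by fun_prop) (B := B) (p := p + 1) fun x => ?_
    rw [abs_mul]
    have hxi : |x i| ≤ ∏ j, (1 + |x j|) := by
      calc |x i| ≤ 1 + |x i| := by linarith [abs_nonneg (x i)]
        _ ≤ ∏ j, (1 + |x j|) := by
            have h := Finset.prod_le_prod (s := (Finset.univ : Finset (Fin (N + 1))).erase i) (f := fun _ => (1 : ℝ))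
              (g := fun j => 1 + |x j|) (fun _ _ => zero_le_one) (fun j _ => by linarith [abs_nonneg (x j)])
            rw [Finset.prod_const_one] at h
            rw [← Finset.mul_prod_erase _ _ (Finset.mem_univ i)]
            have h0 : (0 : ℝ) ≤ 1 + |x i| := by positivity
            nlinarith
    calc |x i| * |G x| ≤ (∏ j, (1 + |x j|)) * (B * ∏ j, (1 + |x j|) ^ p) :=
          mul_le_mul hxi (hGb x) (abs_nonneg _) (by positivity)
      _ = B * ∏ j, (1 + |x j|) ^ (p + 1) := by
          rw [mul_comm, mul_assoc, ← Finset.prod_mul_distrib]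
          exact congrArg _ (Finset.prod_congr rfl fun j _ => by ring)
  have hint2 : Integrable (fun x => fderiv ℝ G x (Pi.single i 1)) (piGauss (N + 1)) :=
    integrable_piGauss_of_abs_le hG'c.aestronglyMeasurable hG'b
  -- split off the `i`-th coordinate
  set e := MeasurableEquiv.piFinSuccAbove (fun _ : Fin (N + 1) => ℝ) i with he
  have hmp : MeasurePreserving e (piGauss (N + 1)) ((gaussianReal 0 1).prod (piGauss N)) :=
    measurePreserving_piFinSuccAbove (fun _ : Fin (N + 1) => gaussianReal 0 1) i
  have hsymm : ∀ z : ℝ × (Fin N → ℝ), e.symm z = Fin.insertNth i z.1 z.2 := fun z => rfl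
  have htrans : ∀ {f : (Fin (N + 1) → ℝ) → ℝ}, Integrable f (piGauss (N + 1)) →
      ∫ x, f x ∂(piGauss (N + 1)) = ∫ y, ∫ t, f (Fin.insertNth i t y) ∂(gaussianReal 0 1) ∂(piGauss N) := by
    intro f hf
    rw [← (hmp.symm e).integral_comp e.symm.measurableEmbedding]
    have hf' : Integrable (fun z : ℝ × (Fin N → ℝ) => f (e.symm z)) ((gaussianReal 0 1).prod (piGauss N)) :=
      (hmp.symm e).integrable_comp_emb e.symm.measurableEmbedding |>.2 hf
    rw [integral_prod_symm _ hf']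
    rfl
  rw [htrans hint1, htrans hint2]
  refine integral_congr_ae (ae_of_all _ fun y => ?_)
  -- the one-dimensional Stein identity in the `i`-th coordinate
  simp only [Fin.insertNth_apply_same]
  set c : Fin (N + 1) → ℝ := Fin.insertNth i (0 : ℝ) y with hc
  set v : Fin (N + 1) → ℝ := Pi.single i 1 with hv
  have hline : ∀ t, Fin.insertNth i t y = c + t • v := fun t => insertNth_eq_add_smul i t y
  have hderiv : ∀ t, HasDerivAt (fun t => G (Fin.insertNth i t y)) (fderiv ℝ G (Fin.insertNth i t y) (Pi.single i 1)) t := by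
    intro t
    have h1 : HasDerivAt (fun t : ℝ => c + t • v) v t := by
      simpa using ((hasDerivAt_id t).smul_const v).const_add c
    have h2 := ((hG.differentiable one_ne_zero) (c + t • v)).hasFDerivAt.comp_hasDerivAt t h1
    simp only [Function.comp_def, ← hline] at h2
    exact h2
  set By : ℝ := B * ∏ j, (1 + |y j|) ^ p with hBy
  have hb1 : ∀ t, |G (Fin.insertNth i t y)| ≤ By * (1 + |t|) ^ p := fun t => by
    rw [hBy, mul_assoc, mul_comm (∏ j, (1 + |y j|) ^ p), ← prod_weight_insertNth i p t y]; exact hGb _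
  have hb2 : ∀ t, |fderiv ℝ G (Fin.insertNth i t y) (Pi.single i 1)| ≤ By * (1 + |t|) ^ p := fun t => by
    rw [hBy, mul_assoc, mul_comm (∏ j, (1 + |y j|) ^ p), ← prod_weight_insertNth i p t y]; exact hG'b _
  exact stein hderiv (hG'c.comp (by fun_prop)) hb1 hb2

/-! ### Gaussian integration by parts for linear images of the product Gaussian -/

/-- `1 + Σ_j t_j ≤ ∏_j (1 + t_j)` for `t_j ≥ 0`. [folklore] -/
theorem one_add_sum_le_prod {ι : Type*} (s : Finset ι) (t : ι → ℝ) (ht : ∀ i ∈ s, 0 ≤ t i) :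
    1 + ∑ i ∈ s, t i ≤ ∏ i ∈ s, (1 + t i) := by
  classical
  induction s using Finset.induction_on with
  | empty => simp
  | insert a s ha ih =>
      rw [Finset.sum_insert ha, Finset.prod_insert ha]
      have hta : 0 ≤ t a := ht a (Finset.mem_insert_self a s)
      have hs : ∀ i ∈ s, 0 ≤ t i := fun i hi => ht i (Finset.mem_insert_of_mem hi)
      have ih' := ih hs
      have hsum : 0 ≤ ∑ i ∈ s, t i := Finset.sum_nonneg hs
      nlinarith

/-- The sup norm weight is dominated by the product weight: `(1+‖x‖)^p ≤ ∏_j (1+|x_j|)^p`. [folklore] -/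
theorem one_add_norm_pow_le_prod {N : ℕ} (x : Fin N → ℝ) (p : ℕ) : (1 + ‖x‖) ^ p ≤ ∏ j, (1 + |x j|) ^ p := by
  rw [Finset.prod_pow]
  apply pow_le_pow_left₀ (by positivity)
  have h1 : ‖x‖ ≤ ∑ j, |x j| := by
    refine (pi_norm_le_iff_of_nonneg (Finset.sum_nonneg fun j _ => abs_nonneg (x j))).2 fun j => ?_
    rw [Real.norm_eq_abs]
    exact Finset.single_le_sum (f := fun j => |x j|) (fun j _ => abs_nonneg _) (Finset.mem_univ j)
  have h2 := one_add_sum_le_prod (Finset.univ : Finset (Fin N)) (fun j => |x j|) fun j _ => abs_nonneg (x j)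
  linarith

variable {Λ' : Type*} [Fintype Λ'] [DecidableEq Λ']

/-- The matrix of a linear map from the product space: `a_{uk} = (A e_k)_u`. [folklore] -/
def lmat {N : ℕ} (A : (Fin N → ℝ) →L[ℝ] (Λ' → ℝ)) (u : Λ') (k : Fin N) : ℝ := A (Pi.single k 1) u

omit [Fintype Λ'] [DecidableEq Λ'] in
/-- `(Ax)_u = Σ_k a_{uk} x_k`. [folklore] -/
theorem apply_eq_sum_lmat {N : ℕ} (A : (Fin N → ℝ) →L[ℝ] (Λ' → ℝ)) (x : Fin N → ℝ) (u : Λ') :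
    A x u = ∑ k, lmat A u k * x k := by
  conv_lhs => rw [pi_eq_sum_univ' x]
  rw [map_sum, Finset.sum_apply]
  refine Finset.sum_congr rfl fun k _ => ?_
  rw [map_smul, Pi.smul_apply, smul_eq_mul, lmat, mul_comm]

/-- `A e_k = Σ_v a_{vk} e_v`. [folklore] -/
theorem apply_single_eq_sum {N : ℕ} (A : (Fin N → ℝ) →L[ℝ] (Λ' → ℝ)) (k : Fin N) :
    A (Pi.single k 1) = ∑ v, lmat A v k • (Pi.single v (1 : ℝ) : Λ' → ℝ) := by
  conv_lhs => rw [pi_eq_sum_univ' (A (Pi.single k 1))]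
  rfl

/-- **Gaussian integration by parts for the linear image `μ = A_* N(0,1)^{⊗N}`** (a centred
Gaussian with covariance `Ĉ = aaᵀ`): `∫ ζ_u F(ζ) dμ = Σ_v Ĉ_{uv} ∫ ∂_vF(ζ) dμ` for `C¹`
functions `F` with `|F(ζ)| ≤ B(1+‖ζ‖)^p` and `‖DF(ζ)‖ ≤ B(1+‖ζ‖)^p`. [cite: BrydgesSlade2015RGI, §2 (Gaussian integration by parts)] -/
theorem map_ibp {N : ℕ} (A : (Fin N → ℝ) →L[ℝ] (Λ' → ℝ)) {F : (Λ' → ℝ) → ℝ} (hF : ContDiff ℝ 1 F) {B : ℝ} {p : ℕ}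
    (hFb : ∀ ζ, |F ζ| ≤ B * (1 + ‖ζ‖) ^ p) (hF'b : ∀ ζ, ‖fderiv ℝ F ζ‖ ≤ B * (1 + ‖ζ‖) ^ p) (u : Λ') :
    ∫ ζ, ζ u * F ζ ∂((piGauss N).map A) =
      ∑ v, (∑ k, lmat A u k * lmat A v k) * ∫ ζ, fderiv ℝ F ζ (Pi.single v 1) ∂((piGauss N).map A) := by
  have hAm : AEMeasurable A (piGauss N) := A.continuous.measurable.aemeasurable
  have hFc : Continuous F := hF.continuous
  have hF'c : ∀ w : Λ' → ℝ, Continuous fun ζ => fderiv ℝ F ζ w := fun w => (hF.continuous_fderiv one_ne_zero).clm_apply continuous_const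
  have hB : 0 ≤ B := by
    have := hFb 0; simp at this; exact (abs_nonneg _).trans this
  -- the composite `G = F ∘ A` and its growth in product form
  set G : (Fin N → ℝ) → ℝ := fun x => F (A x) with hG
  have hGs : ContDiff ℝ 1 G := hF.comp A.contDiff
  set B' : ℝ := B * (1 + ‖A‖) ^ p with hB'
  have hnormA : ∀ x : Fin N → ℝ, 1 + ‖A x‖ ≤ (1 + ‖A‖) * (1 + ‖x‖) := by
    intro x
    have h1 := A.le_opNorm x
    have h2 : 0 ≤ ‖A‖ := norm_nonneg _
    have h3 : 0 ≤ ‖x‖ := norm_nonneg _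
    nlinarith
  have hweight : ∀ x : Fin N → ℝ, (1 + ‖A x‖) ^ p ≤ (1 + ‖A‖) ^ p * ∏ j, (1 + |x j|) ^ p := by
    intro x
    calc (1 + ‖A x‖) ^ p ≤ ((1 + ‖A‖) * (1 + ‖x‖)) ^ p := pow_le_pow_left₀ (by positivity) (hnormA x) p
      _ = (1 + ‖A‖) ^ p * (1 + ‖x‖) ^ p := mul_pow _ _ _
      _ ≤ (1 + ‖A‖) ^ p * ∏ j, (1 + |x j|) ^ p := mul_le_mul_of_nonneg_left (one_add_norm_pow_le_prod x p) (by positivity)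
  have hGb : ∀ x, |G x| ≤ B' * ∏ j, (1 + |x j|) ^ p := fun x =>
    (hFb (A x)).trans (by rw [hB', mul_assoc]; exact mul_le_mul_of_nonneg_left (hweight x) hB)
  have hfderivG : ∀ x w, fderiv ℝ G x w = fderiv ℝ F (A x) (A w) := by
    intro x w
    rw [hG, show (fun x => F (A x)) = F ∘ A from rfl, fderiv_comp x ((hF.differentiable one_ne_zero) _) A.differentiableAt,
      A.fderiv]
    rfl
  have hG'b : ∀ k x, |fderiv ℝ G x (Pi.single k 1)| ≤ (B' * ‖A‖) * ∏ j, (1 + |x j|) ^ p := by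
    intro k x
    rw [hfderivG]
    have h1 := (fderiv ℝ F (A x)).le_opNorm (A (Pi.single k 1))
    have h2 : ‖A (Pi.single k (1 : ℝ))‖ ≤ ‖A‖ := by
      have := A.le_opNorm (Pi.single k (1 : ℝ))
      have hs : ‖(Pi.single k (1 : ℝ) : Fin N → ℝ)‖ = 1 := by
        rw [Pi.norm_single, norm_one]
      rw [hs, mul_one] at this
      exact this
    rw [← Real.norm_eq_abs]
    calc ‖fderiv ℝ F (A x) (A (Pi.single k 1))‖ ≤ ‖fderiv ℝ F (A x)‖ * ‖A (Pi.single k 1)‖ := h1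
      _ ≤ B * (1 + ‖A x‖) ^ p * ‖A‖ := mul_le_mul (hF'b _) h2 (norm_nonneg _) (by positivity)
      _ ≤ B * ((1 + ‖A‖) ^ p * ∏ j, (1 + |x j|) ^ p) * ‖A‖ :=
          mul_le_mul_of_nonneg_right (mul_le_mul_of_nonneg_left (hweight x) hB) (norm_nonneg _)
      _ = B' * ‖A‖ * ∏ j, (1 + |x j|) ^ p := by rw [hB']; ring
  -- move to the product space
  rw [integral_map hAm (by fun_prop)]
  have hlhs : ∀ x : Fin N → ℝ, A x u * F (A x) = ∑ k, lmat A u k * (x k * G x) := by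
    intro x
    rw [apply_eq_sum_lmat, Finset.sum_mul]
    exact Finset.sum_congr rfl fun k _ => by rw [hG]; ring
  simp only [hlhs]
  have hint_k : ∀ k, Integrable (fun x => x k * G x) (piGauss N) := by
    intro k
    cases N with
    | zero => exact k.elim0
    | succ N =>
        refine integrable_piGauss_of_abs_le (by fun_prop) (B := B') (p := p + 1) fun x => ?_
        rw [abs_mul]
        have hxi : |x k| ≤ ∏ j, (1 + |x j|) := by
          calc |x k| ≤ 1 + |x k| := by linarith [abs_nonneg (x k)]
            _ ≤ ∏ j, (1 + |x j|) := by
                rw [← Finset.mul_prod_erase _ _ (Finset.mem_univ k)]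
                have h := Finset.prod_le_prod (s := (Finset.univ : Finset (Fin (N + 1))).erase k) (f := fun _ => (1 : ℝ))
                  (g := fun j => 1 + |x j|) (fun _ _ => zero_le_one) (fun j _ => by linarith [abs_nonneg (x j)])
                rw [Finset.prod_const_one] at h
                have h0 : (0 : ℝ) ≤ 1 + |x k| := by positivity
                nlinarith
        have hB'0 : 0 ≤ B' := by positivity
        calc |x k| * |G x| ≤ (∏ j, (1 + |x j|)) * (B' * ∏ j, (1 + |x j|) ^ p) :=
              mul_le_mul hxi (hGb x) (abs_nonneg _) (by positivity)
          _ = B' * ∏ j, (1 + |x j|) ^ (p + 1) := by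
              rw [mul_comm, mul_assoc, ← Finset.prod_mul_distrib]
              exact congrArg _ (Finset.prod_congr rfl fun j _ => by ring)
  rw [integral_finsetSum _ fun k _ => (hint_k k).const_mul _]
  simp only [integral_const_mul]
  -- integrate by parts in each coordinate
  have hibp : ∀ k, ∫ x, x k * G x ∂(piGauss N) = ∑ v, lmat A v k * ∫ x, fderiv ℝ F (A x) (Pi.single v 1) ∂(piGauss N) := by
    intro k
    cases N with
    | zero => exact k.elim0
    | succ N =>
        have hGb' : ∀ x, |G x| ≤ (B' * (1 + ‖A‖)) * ∏ j, (1 + |x j|) ^ p := fun x =>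
          (hGb x).trans (mul_le_mul_of_nonneg_right (by nlinarith [norm_nonneg A, show (0:ℝ) ≤ B' from by positivity]) (by positivity))
        have hG'b' : ∀ x, |fderiv ℝ G x (Pi.single k 1)| ≤ (B' * (1 + ‖A‖)) * ∏ j, (1 + |x j|) ^ p := fun x =>
          (hG'b k x).trans (mul_le_mul_of_nonneg_right (by nlinarith [norm_nonneg A, show (0:ℝ) ≤ B' from by positivity]) (by positivity))
        rw [piGauss_ibp k hGs hGb' hG'b']
        have h : ∀ x, fderiv ℝ G x (Pi.single k 1) = ∑ v, lmat A v k * fderiv ℝ F (A x) (Pi.single v 1) := by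
          intro x
          rw [hfderivG, apply_single_eq_sum, map_sum]
          exact Finset.sum_congr rfl fun v _ => by rw [map_smul, smul_eq_mul]
        simp only [h]
        have hint_v : ∀ v, Integrable (fun x => fderiv ℝ F (A x) (Pi.single v 1)) (piGauss (N + 1)) := by
          intro v
          refine integrable_piGauss_of_abs_le ((hF'c _).comp A.continuous).aestronglyMeasurable (B := B' ) (p := p) fun x => ?_
          rw [← Real.norm_eq_abs]
          have hs : ‖(Pi.single v (1 : ℝ) : Λ' → ℝ)‖ = 1 := by rw [Pi.norm_single, norm_one]
          calc ‖fderiv ℝ F (A x) (Pi.single v 1)‖ ≤ ‖fderiv ℝ F (A x)‖ * ‖(Pi.single v (1 : ℝ) : Λ' → ℝ)‖ :=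
                (fderiv ℝ F (A x)).le_opNorm _
            _ ≤ B * (1 + ‖A x‖) ^ p := by rw [hs, mul_one]; exact hF'b _
            _ ≤ B' * ∏ j, (1 + |x j|) ^ p := by rw [hB', mul_assoc]; exact mul_le_mul_of_nonneg_left (hweight x) hB
        rw [integral_finsetSum _ fun v _ => (hint_v v).const_mul _]
        simp only [integral_const_mul]
  simp only [hibp, Finset.mul_sum]
  rw [Finset.sum_comm]
  refine Finset.sum_congr rfl fun v _ => ?_
  rw [integral_map hAm (by fun_prop), Finset.sum_mul]
  exact Finset.sum_congr rfl fun k _ => by ring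

variable {Λ : Type*} [Fintype Λ] [DecidableEq Λ] {n : ℕ}

/-- The flattening of the field labels `Λ × [n] ≃ Fin N`. [folklore] -/
def flatIdx (Λ : Type*) [Fintype Λ] [DecidableEq Λ] (n : ℕ) : Λ × Fin n ≃ Fin (Fintype.card (Λ × Fin n)) :=
  Fintype.equivFin (Λ × Fin n)

/-- The square root of `C ⊗ 1ₙ`. [folklore] -/
def sqrtCM (C : Matrix Λ Λ ℝ) (n : ℕ) : Matrix (Λ × Fin n) (Λ × Fin n) ℝ := CFC.sqrt (componentMatrix C n)

/-- **The linear Gaussian map** `z ↦ (x ↦ i ↦ Σ_q √(C⊗1)_{(x,i),q} z_{e(q)})` from the flat product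
space to field space. [folklore] -/
def gaussMap (C : Matrix Λ Λ ℝ) (n : ℕ) : (Fin (Fintype.card (Λ × Fin n)) → ℝ) →L[ℝ] (Λ → Fin n → ℝ) :=
  LinearMap.toContinuousLinearMap
    { toFun := fun z x i => ∑ q, sqrtCM C n (x, i) q * z (flatIdx Λ n q)
      map_add' := fun z z' => by funext x i; simp [mul_add, Finset.sum_add_distrib]
      map_smul' := fun c z => by
        funext x i
        simp only [Pi.smul_apply, smul_eq_mul, RingHom.id_apply, Finset.mul_sum]
        exact Finset.sum_congr rfl fun q _ => by ring }

/-- `gaussMap` in coordinates. [folklore] -/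
theorem gaussMap_apply (C : Matrix Λ Λ ℝ) (z : Fin (Fintype.card (Λ × Fin n)) → ℝ) (x : Λ) (i : Fin n) :
    gaussMap C n z x i = ∑ q, sqrtCM C n (x, i) q * z (flatIdx Λ n q) := rfl

/-- The product Gaussian over `Λ × [n]` is the reindexed product Gaussian over `Fin N`. [folklore] -/
theorem pi_eq_map_reindex :
    (Measure.pi fun _ : Λ × Fin n => gaussianReal 0 1) =
      (Measure.pi fun _ : Fin (Fintype.card (Λ × Fin n)) => gaussianReal 0 1).map
        (fun z q => z (flatIdx Λ n q)) := by
  have h := (measurePreserving_piCongrLeft (fun _ : Λ × Fin n => gaussianReal 0 1) (flatIdx Λ n).symm).map_eq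
  rw [← h]
  congr 1
  funext z
  funext q
  rw [MeasurableEquiv.coe_piCongrLeft, Equiv.piCongrLeft_apply]
  simp [Equiv.symm_symm, eq_rec_constant]

/-- **`P_C` is the linear image of the product Gaussian under `gaussMap`** (for positive
semidefinite `C`). [folklore] -/
theorem fieldGaussian_eq_map_gaussMap (C : Matrix Λ Λ ℝ) :
    fieldGaussian Λ C n = (Measure.pi fun _ : Fin (Fintype.card (Λ × Fin n)) => gaussianReal 0 1).map (gaussMap C n) := by
  unfold fieldGaussian multivariateGaussian
  rw [stdGaussian_eq_map_pi_orthonormalBasis (EuclideanSpace.basisFun (Λ × Fin n) ℝ), pi_eq_map_reindex]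
  have hm1 : Measurable (fun z : Fin (Fintype.card (Λ × Fin n)) → ℝ => fun q : Λ × Fin n => z (flatIdx Λ n q)) :=
    measurable_pi_lambda _ fun q => measurable_pi_apply _
  have hm2 : Measurable (fun x : Λ × Fin n → ℝ => ∑ i, x i • EuclideanSpace.basisFun (Λ × Fin n) ℝ i) :=
    Continuous.measurable (by fun_prop)
  have hm3 : Measurable (fun x : EuclideanSpace ℝ (Λ × Fin n) =>
      (0 : EuclideanSpace ℝ (Λ × Fin n)) + toEuclideanCLM (𝕜 := ℝ) (CFC.sqrt (componentMatrix C n)) x) :=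
    (continuous_const.add (ContinuousLinearMap.continuous _)).measurable
  have hm4 := (fieldEquiv Λ n).measurable
  rw [Measure.map_map hm2 hm1, Measure.map_map hm3 (hm2.comp hm1), Measure.map_map hm4 (hm3.comp (hm2.comp hm1))]
  congr 1
  funext z
  funext x i
  simp only [Function.comp_apply, zero_add, fieldEquiv_apply, gaussMap_apply, sqrtCM]
  have hsum : (∑ q : Λ × Fin n, (fun q => z (flatIdx Λ n q)) q • EuclideanSpace.basisFun (Λ × Fin n) ℝ q) =
      toLp 2 (fun q => z (flatIdx Λ n q)) := by
    ext j
    simp [EuclideanSpace.basisFun_apply, Finset.sum_apply, Pi.single_apply]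
  rw [hsum, Matrix.toEuclideanCLM_toLp]
  rfl

/-- The square root is symmetric and squares to `C ⊗ 1ₙ`. [folklore] -/
theorem sqrtCM_mul_self {C : Matrix Λ Λ ℝ} (hC : C.PosSemidef) : sqrtCM C n * sqrtCM C n = componentMatrix C n :=
  CFC.sqrt_mul_sqrt_self _ (posSemidef_componentMatrix hC).nonneg

/-- The square root is symmetric. [folklore] -/
theorem sqrtCM_transpose {C : Matrix Λ Λ ℝ} (n : ℕ) : (sqrtCM C n)ᵀ = sqrtCM C n := by
  have h : (sqrtCM C n).IsHermitian := (CFC.sqrt_nonneg (componentMatrix C n)).posSemidef.isHermitian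
  have := h.eq
  rwa [Matrix.conjTranspose_eq_transpose_of_trivial] at this

/-- `Σ_k a_{uk}a_{vk} = (C ⊗ 1)_{uv}` for the matrix `a` of `gaussMap` (flattened target). [folklore] -/
theorem sum_sqrtCM_mul_sqrtCM {C : Matrix Λ Λ ℝ} (hC : C.PosSemidef) (u v : Λ × Fin n) :
    ∑ q, sqrtCM C n u q * sqrtCM C n v q = componentMatrix C n u v := by
  rw [← sqrtCM_mul_self hC, Matrix.mul_apply]
  refine Finset.sum_congr rfl fun q _ => ?_
  rw [show sqrtCM C n q v = (sqrtCM C n)ᵀ v q from rfl, sqrtCM_transpose]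

/-! ### Gaussian integration by parts on field space: `E_C[ζ^i_x F(ζ)] = Σ_y C_{xy} E_C[∂_{(y,i)}F(ζ)]` -/

/-- Currying `Λ × [n] → ℝ ≃ (Λ → [n] → ℝ)` as a continuous linear equivalence. [folklore] -/
def curryCLE (Λ : Type*) [Fintype Λ] (n : ℕ) : (Λ × Fin n → ℝ) ≃L[ℝ] (Λ → Fin n → ℝ) :=
  LinearEquiv.toContinuousLinearEquiv
    { toFun := fun ζ x i => ζ (x, i)
      invFun := fun φ q => φ q.1 q.2
      map_add' := fun _ _ => rfl
      map_smul' := fun _ _ => rfl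
      left_inv := fun _ => rfl
      right_inv := fun _ => rfl }

omit [DecidableEq Λ] in
/-- `curry ζ x i = ζ (x,i)`. [folklore] -/
@[simp] theorem curryCLE_apply (ζ : Λ × Fin n → ℝ) (x : Λ) (i : Fin n) : curryCLE Λ n ζ x i = ζ (x, i) := rfl

omit [DecidableEq Λ] in
/-- Currying preserves the sup norm. [folklore] -/
theorem norm_curryCLE (ζ : Λ × Fin n → ℝ) : ‖curryCLE Λ n ζ‖ = ‖ζ‖ := by
  apply le_antisymm
  · refine (pi_norm_le_iff_of_nonneg (norm_nonneg ζ)).2 fun x => (pi_norm_le_iff_of_nonneg (norm_nonneg ζ)).2 fun i => ?_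
    rw [curryCLE_apply]
    exact norm_le_pi_norm ζ (x, i)
  · refine (pi_norm_le_iff_of_nonneg (norm_nonneg _)).2 fun q => ?_
    calc ‖ζ q‖ = ‖curryCLE Λ n ζ q.1 q.2‖ := rfl
      _ ≤ ‖curryCLE Λ n ζ q.1‖ := norm_le_pi_norm _ q.2
      _ ≤ ‖curryCLE Λ n ζ‖ := norm_le_pi_norm _ q.1

/-- The coordinate direction `e_{(y,i)}` in field space. [folklore] -/
def fdir (y : Λ) (i : Fin n) : Λ → Fin n → ℝ := fun x j => if x = y ∧ j = i then 1 else 0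

omit [Fintype Λ] in
/-- `curry e_{(y,i)} = e_{(y,i)}`. [folklore] -/
theorem curry_single (y : Λ) (i : Fin n) (x : Λ) (j : Fin n) :
    (Pi.single (M := fun _ => ℝ) (y, i) (1 : ℝ) : Λ × Fin n → ℝ) (x, j) = fdir y i x j := by
  simp only [fdir, Pi.single_apply, Prod.mk.injEq]

/-- **Gaussian integration by parts for `P_C` on field space**:
`E_C[ζ^i_x F(ζ)] = Σ_y C_{xy} E_C[(∂F/∂ζ^i_y)(ζ)]` for positive semidefinite `C` and `C¹` functions
`F` with `|F(φ)| ≤ B(1+‖φ‖)^p`, `‖DF(φ)‖ ≤ B(1+‖φ‖)^p`. [cite: BrydgesSlade2015RGI, §2 (Gaussian integration by parts)] [cite: Slade2017, §4.1 (the Gaussian measure P_C and E_C)] -/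
theorem fieldGaussian_ibp {C : Matrix Λ Λ ℝ} (hC : C.PosSemidef) {F : (Λ → Fin n → ℝ) → ℝ} (hF : ContDiff ℝ 1 F)
    {B : ℝ} {p : ℕ} (hFb : ∀ φ, |F φ| ≤ B * (1 + ‖φ‖) ^ p) (hF'b : ∀ φ, ‖fderiv ℝ F φ‖ ≤ B * (1 + ‖φ‖) ^ p)
    (x : Λ) (i : Fin n) :
    ∫ φ, φ x i * F φ ∂(fieldGaussian Λ C n) = ∑ y, C x y * ∫ φ, fderiv ℝ F φ (fdir y i) ∂(fieldGaussian Λ C n) := by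
  set N := Fintype.card (Λ × Fin n) with hN
  -- flat picture
  set Afl : (Fin N → ℝ) →L[ℝ] (Λ × Fin n → ℝ) := ((curryCLE Λ n).symm : (Λ → Fin n → ℝ) →L[ℝ] (Λ × Fin n → ℝ)).comp (gaussMap C n)
    with hAfl
  set F' : (Λ × Fin n → ℝ) → ℝ := fun ζ => F (curryCLE Λ n ζ) with hF'
  have hF's : ContDiff ℝ 1 F' := hF.comp (curryCLE Λ n).contDiff
  have hF'b1 : ∀ ζ, |F' ζ| ≤ B * (1 + ‖ζ‖) ^ p := fun ζ => by rw [hF', ← norm_curryCLE ζ]; exact hFb _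
  have hfd : ∀ ζ w, fderiv ℝ F' ζ w = fderiv ℝ F (curryCLE Λ n ζ) (curryCLE Λ n w) := by
    intro ζ w
    rw [hF', show (fun ζ => F (curryCLE Λ n ζ)) = F ∘ (curryCLE Λ n) from rfl,
      fderiv_comp ζ ((hF.differentiable one_ne_zero) _) (curryCLE Λ n).differentiableAt, (curryCLE Λ n).fderiv]
    rfl
  have hF'b2 : ∀ ζ, ‖fderiv ℝ F' ζ‖ ≤ B * (1 + ‖ζ‖) ^ p := by
    intro ζ
    refine ContinuousLinearMap.opNorm_le_bound _ (by
      have := hFb 0; simp at this; have hB := (abs_nonneg _).trans this; positivity) fun w => ?_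
    rw [hfd]
    calc ‖fderiv ℝ F (curryCLE Λ n ζ) (curryCLE Λ n w)‖ ≤ ‖fderiv ℝ F (curryCLE Λ n ζ)‖ * ‖curryCLE Λ n w‖ :=
          (fderiv ℝ F _).le_opNorm _
      _ ≤ B * (1 + ‖curryCLE Λ n ζ‖) ^ p * ‖curryCLE Λ n w‖ := mul_le_mul_of_nonneg_right (hF'b _) (norm_nonneg _)
      _ = B * (1 + ‖ζ‖) ^ p * ‖w‖ := by rw [norm_curryCLE, norm_curryCLE]
  -- the measures
  have hmeas : fieldGaussian Λ C n = ((piGauss N).map Afl).map (curryCLE Λ n) := by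
    rw [fieldGaussian_eq_map_gaussMap, Measure.map_map (curryCLE Λ n).continuous.measurable Afl.continuous.measurable]
    rfl
  have hint_eq : ∀ (G : (Λ → Fin n → ℝ) → ℝ), ∫ φ, G φ ∂(fieldGaussian Λ C n) = ∫ ζ, G (curryCLE Λ n ζ) ∂((piGauss N).map Afl) := by
    intro G
    rw [hmeas]
    exact integral_map_equiv ((curryCLE Λ n).toHomeomorph.toMeasurableEquiv) G
  rw [hint_eq, Finset.sum_congr rfl fun y _ => by rw [hint_eq]]
  -- apply the flat integration by parts
  have key := map_ibp Afl hF's hF'b1 hF'b2 (x, i)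
  have hlhs : (fun ζ : Λ × Fin n → ℝ => ζ (x, i) * F' ζ) = fun ζ => (curryCLE Λ n ζ) x i * F (curryCLE Λ n ζ) := rfl
  rw [hlhs] at key
  rw [key]
  -- identify the covariance `Σ_k a_{uk}a_{vk} = (C ⊗ 1)_{uv}` and the directions
  have hlmat : ∀ (u : Λ × Fin n) (k : Fin N), lmat Afl u k = sqrtCM C n u ((flatIdx Λ n).symm k) := by
    intro u k
    simp only [lmat, hAfl, ContinuousLinearMap.comp_apply]
    show gaussMap C n (Pi.single k 1) u.1 u.2 = _
    rw [gaussMap_apply, Finset.sum_eq_single ((flatIdx Λ n).symm k)]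
    · simp
    · intro q _ hq
      have : flatIdx Λ n q ≠ k := fun h => hq (by rw [← h, Equiv.symm_apply_apply])
      simp [this]
    · intro h; exact absurd (Finset.mem_univ _) h
  have hcov : ∀ u v : Λ × Fin n, ∑ k, lmat Afl u k * lmat Afl v k = componentMatrix C n u v := by
    intro u v
    simp only [hlmat]
    rw [← sum_sqrtCM_mul_sqrtCM hC u v]
    exact Fintype.sum_equiv (flatIdx Λ n).symm _ _ fun k => rfl
  simp only [hcov, componentMatrix_apply]
  -- sum over `v = (y, j)`: only `j = i` survives
  rw [Fintype.sum_prod_type]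
  refine Finset.sum_congr rfl fun y _ => ?_
  rw [Finset.sum_eq_single i]
  · simp only [if_true]
    congr 1
    refine integral_congr_ae (ae_of_all _ fun ζ => ?_)
    show fderiv ℝ F' ζ (Pi.single (y, i) 1) = fderiv ℝ F (curryCLE Λ n ζ) (fdir y i)
    rw [hfd]
    congr 1
    funext x' j
    rw [curryCLE_apply, curry_single]
  · intro j _ hj; rw [if_neg (Ne.symm hj), zero_mul]
  · intro h; exact absurd (Finset.mem_univ _) h

end GaussIBP

end LongRangePhi4

end Literature.Barriers.CriticalPhenomena

end
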